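import Summits.ResolutionOfSingularities.ResolutionOfSingularities.Theorems.FrobeniusClosingSteerRadicandChainTwo
import Literature.AlgebraicGeometry.Resolution.CossartPiltantHironakaLocalUniformizationBranch
import Literature.AlgebraicGeometry.Resolution.QuadraticTransforms
import Literature.AlgebraicGeometry.Resolution.ExcellentRings
import Mathlib.RingTheory.Valuation.LocalSubring
import HarnessLib

/-!
# Crux `Steer` (stmt-ResolutionOfSingularities-16345), chain W4.1, R2 σ_top line: **K(3)** — no eternal isolated
# radicand chain in codimension three, from Cossart–Piltant's Hironaka-local uniformization (Theses-free)

OURS (campaign `res-hironaka`, rung L ★L-G4, slot W4.1; holder of record res-L0-w41-lead-1 g4; replaces the role of no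
printed item; NOT a statement of the manuscript under review [claim: Hironaka2017, status: under-review]; AI review is
weaker than expert review).

The p = 2 σ_top composition of the `Steer` skeleton (`Cruxes/Steer/Lines/switching_dichotomy.lean` r23, §σ2.4
`eternalSteeredRunTwo_of`) consumes three K-inputs `NoEternalIsolatedRadicandChain p c`, `c = 1, 2, 3` (res-L0-w41-idea-1's
definition, `L/w41/Sketch-R2-steered.lean` §3.1): no infinite sequence of quadratic transforms of excellent regular
local rings `S m ⊆ L` of dimension `c` (`char L = p`) carrying radicands `f m` with `f (m+1) · (x m)^p = f m − (g m)^p`,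
of cleaned multiplicity `p` (`f m − h^p ∈ 𝔪^p`) and with ISOLATED torsor singularity (`(S m)[X]/(X^p − f m)` regular at
every non-maximal prime) at every stage. K(1) is the tree's `NoEternalChainOne.noEternalIsolatedRadicandChain_one`
(p500126); K(2) is `RadicandChainTwo.noEternalIsolatedRadicandChain_two` modulo Lipman 1978 (p505893). The chain had
recorded K(3) as OPEN («it would not contradict CP2019 (existence of SOME resolving sequence says nothing about this
branch)», idea-1's card). THIS FILE closes K(3) modulo the NAMED FACT
`Literature.AlgebraicGeometry.Resolution.CossartPiltant2019HironakaLUIsolatedBranch` = Cossart–Piltant 2019 **Thm. 1.4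
(i)** (local uniformization of `X^p − f` over an excellent regular THREE-dimensional local ring along ANY valuation BY
LOCAL HIRONAKA-PERMISSIBLE BLOWING UPS, arXiv:1412.0868v1 p. 4) followed along a branch of isolated singular closed points
(Def. 2.7 (i) p. 14: a Hironaka-permissible centre `𝒴 ∋ x` has `m(y) = m(x)`, so at an isolated singular point it is the
point; Prop. 2.7: the point blowing-up is `X'^p − u^{-p}(f − θ^p)` over the quadratic transform of the base along the
valuation). No residue-field / p-rank / derivation hypothesis enters («we do not even assume that `[k:k^p] < +∞`», loc.
cit.), so the finite-p-rank refinements `…Fin` / `…FinAt` / `…Finrank` of the skeleton (§σ2.11/§σ2.13) are not needed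
for `c = 3`.

## The proof (`NoEternalChainThree.noEternalIsolatedRadicandChain_three`)

Given an eternal chain `S : ℕ → Subring L` as in K(3): (1) the union `⋃ S m` is a local subring of `L` (the inclusions
`S m → S (m+1)` are local: a quadratic transform dominates its source), so by Chevalley (Mathlib
`LocalSubring.exists_le_valuationSubring`) some valuation ring `O` of `L` dominates every `S m`
(`exists_valuationSubring_dominates`); (2) each `S (m+1)`, a quadratic transform of `S m` lying in `O` and dominated by
it, is THE quadratic transform of `S m` along `O` (tree `IsQuadraticTransform.along`); (3) the first torsor germ is
reduced (`RadicandChainTwo.isReduced_of_isolated`: isolated singularity over a local domain which is not a field);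
(4) the named fact yields a REGULAR member `(S r)[X]/(X^p − f r)`; (5) which contradicts the cleaned multiplicity
`f r − h^p ∈ 𝔪^p ⊆ 𝔪²` (`RadicandChainTwo.not_isRegularLocalRing_of_sub_pow_mem_sq`). By-name leaf for the skeleton's
e-free K(3) slot: `fun p hp => NoEternalChainThree.noEternalIsolatedRadicandChain_three hCP p hp`.
[cite: CossartPiltant2019, Thm. 1.4 (i), Def. 2.7, Prop. 2.7] [cite: Matsumura1987, Thm. 10.2] [folklore]
-/

noncomputable section

-- `Summit.<S>.<S>.…` duplicates the summit name by design (single-problem summit).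
set_option linter.dupNamespace false

open Polynomial IsLocalRing

namespace Summit.ResolutionOfSingularities.ResolutionOfSingularities.Theorems.SwitchingDichotomy

open Literature.AlgebraicGeometry.Resolution

namespace NoEternalChainThree

/-! ## (1) A valuation ring dominating a branch of local subrings -/

section Branch

variable {L : Type} [Field L]

/-- Along a monotone sequence of subrings in which each member dominates the previous one, every later member
dominates every earlier one. [folklore] -/
theorem subringDominates_of_le (S : ℕ → Subring L) (hdom : ∀ m, SubringDominates (S m) (S (m + 1)))
    {m n : ℕ} (hmn : m ≤ n) : SubringDominates (S m) (S n) := by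
  induction hmn with
  | refl => exact SubringDominates.refl _
  | step _ ih => exact ih.trans (hdom _)

/-- **Chevalley along a branch**: for a sequence of LOCAL subrings `S m` of a field, each dominating the previous
one, some valuation ring of the field dominates every member (the union is a local subring — units and non-units
are decided at a finite stage — and a local subring is dominated by a valuation ring, Mathlib
`LocalSubring.exists_le_valuationSubring`). [cite: Matsumura1987, Thm. 10.2] [folklore] -/
theorem exists_valuationSubring_dominates (S : ℕ → Subring L) [∀ m, IsLocalRing (S m)]
    (hdom : ∀ m, SubringDominates (S m) (S (m + 1))) :
    ∃ O : ValuationSubring L, ∀ m, SubringDominates (S m) O.toSubring := by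
  classical
  have hmono : Monotone S := monotone_nat_of_le_succ fun m => (hdom m).1
  have hdir : Directed (· ≤ ·) S := hmono.directed_le
  set U : Subring L := ⨆ m, S m with hU
  have hSU : ∀ m, S m ≤ U := fun m => le_iSup S m
  have hmem : ∀ {z : L}, z ∈ U → ∃ m, z ∈ S m := fun hz => (Subring.mem_iSup_of_directed hdir).mp hz
  -- a unit of `U` lying in `S m` is a unit of `S m`
  have hunit : ∀ m (a : S m), IsUnit (Subring.inclusion (hSU m) a) → IsUnit a := by
    intro m a ha
    rw [isUnit_subring_iff_inv_mem] at ha ⊢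
    refine ⟨ha.1, ?_⟩
    obtain ⟨n, hn⟩ := hmem ha.2
    exact (subringDominates_of_le S hdom (le_max_left m n)).2 _ a.2
      ((hmono (le_max_right m n)) hn)
  -- `U` is local
  haveI hUloc : IsLocalRing U := by
    refine ⟨fun {a b} hab => ?_⟩
    obtain ⟨m, hm⟩ := hmem a.2
    obtain ⟨n, hn⟩ := hmem b.2
    have ha' : (a : L) ∈ S (max m n) := hmono (le_max_left m n) hm
    have hb' : (b : L) ∈ S (max m n) := hmono (le_max_right m n) hn
    have hab' : (⟨(a : L), ha'⟩ : S (max m n)) + ⟨(b : L), hb'⟩ = 1 :=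
      Subtype.ext (by simpa using congrArg Subtype.val hab)
    have ea : Subring.inclusion (hSU (max m n)) ⟨(a : L), ha'⟩ = a := Subtype.ext rfl
    have eb : Subring.inclusion (hSU (max m n)) ⟨(b : L), hb'⟩ = b := Subtype.ext rfl
    rcases IsLocalRing.isUnit_or_isUnit_of_add_one hab' with h | h
    · exact Or.inl (ea ▸ h.map (Subring.inclusion (hSU (max m n))))
    · exact Or.inr (eb ▸ h.map (Subring.inclusion (hSU (max m n))))
  obtain ⟨B, hB⟩ := (LocalSubring.mk U).exists_le_valuationSubring
  refine ⟨B, fun m => ?_⟩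
  have hmU : LocalSubring.mk (S m) ≤ LocalSubring.mk U := ⟨hSU m, ⟨fun a ha => hunit m a ha⟩⟩
  haveI : IsLocalRing B.toSubring := inferInstanceAs (IsLocalRing B)
  exact (subringDominates_iff (S m) B.toSubring).mpr (hmU.trans hB)

end Branch

/-! ## (2) K(3) from Cossart–Piltant's Theorem 1.4 (i) -/

/-- **K(3) — `NoEternalIsolatedRadicandChain p 3`, conditional on `CossartPiltant2019HironakaLUIsolatedBranch`**
(idea-1's statement, `L/w41/Sketch-R2-steered.lean` §3.1 = skeleton r23 §σ2.1, VERBATIM with `c = 3` and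
`HasIsolatedSingularity` / `RadicandRing` unfolded): there is no infinite sequence of quadratic transforms of
excellent regular local rings of dimension THREE inside a field of characteristic `p`, carrying radicands `f m`
with `f (m+1) · (x m)^p = f m − (g m)^p` (`x m` the exceptional parameter), of multiplicity `p` after cleaning,
with isolated torsor singularity at every stage. Proof: module docstring (valuation dominating the branch, the
transforms are along it, the first germ is reduced, Cossart–Piltant's regular member contradicts multiplicity `p`).
By-name leaf for the skeleton's e-free K(3) slot:
`fun p hp => NoEternalChainThree.noEternalIsolatedRadicandChain_three hCP p hp`.
[cite: CossartPiltant2019, Thm. 1.4 (i), Def. 2.7, Prop. 2.7] [folklore] -/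
theorem noEternalIsolatedRadicandChain_three (hCP : CossartPiltant2019HironakaLUIsolatedBranch.{0})
    (p : ℕ) (hp : p.Prime) :
    ∀ (L : Type) [Field L] [CharP L p] (S : ℕ → Subring L) [∀ m, IsLocalRing (S m)]
      (hle : ∀ m, S m ≤ S (m + 1)) (f g : ∀ m, S m) (x : ∀ m, S (m + 1)),
      (∀ m, IsRegularLocalRing (S m)) → (∀ m, IsExcellentRing (S m)) → (∀ m, ringKrullDim (S m) = (3 : ℕ)) →
      (∀ m, IsQuadraticTransform (S m) (S (m + 1))) →
      (∀ m, Ideal.span ((fun y : S m => (⟨(y : L), hle m y.2⟩ : S (m + 1))) ''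
          (maximalIdeal (S m) : Set (S m))) = Ideal.span {x m}) →
      (∀ m, ((f (m + 1) : S (m + 1)) : L) * ((x m : S (m + 1)) : L) ^ p =
          ((f m : S m) : L) - ((g m : S m) : L) ^ p) →
      (∀ m, ∃ h : S m, f m - h ^ p ∈ maximalIdeal (S m) ^ p) →
      (∀ m, ∀ (P : Ideal (AdjoinRoot ((X : (S m)[X]) ^ p - C (f m)))) [P.IsPrime],
          (∃ Q : Ideal (AdjoinRoot ((X : (S m)[X]) ^ p - C (f m))), Q.IsPrime ∧ P < Q) →
          IsRegularLocalRing (Localization.AtPrime P)) →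
      False := by
  intro L _ _ S _ hle f g x hreg hexc hdim hQT hspan hrel hmult hisol
  classical
  haveI := Fact.mk hp
  -- (1) a valuation ring of `L` dominating every member
  obtain ⟨O, hO⟩ := exists_valuationSubring_dominates S fun m => (hQT m).dominates
  -- (2) the transforms are the transforms ALONG `O`
  have halong : ∀ m, IsQuadraticTransformAlong O (S m) (S (m + 1)) := fun m => by
    haveI := hreg m
    exact (hQT m).along ⟨inferInstance, IsNoetherian.noetherian _⟩ (hO (m + 1))
  -- (3) the first germ is reduced (isolated singularity over a local domain which is not a field)
  have hred : IsReduced (AdjoinRoot ((X : (S 0)[X]) ^ p - C (f 0))) := by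
    haveI := hreg 0
    haveI := isDomain_of_isRegularLocalRing (S 0)
    have hS : maximalIdeal (S 0) ≠ ⊥ := by
      intro h
      have h0 := ringKrullDim_eq_zero_of_isField ((isField_iff_maximalIdeal_eq).mpr h)
      rw [hdim 0] at h0
      have h3 : (3 : ℕ) = 0 := by exact_mod_cast h0
      omega
    haveI : CharP (S 0) p := inferInstance
    exact RadicandChainTwo.isReduced_of_isolated p (f 0) hS (hisol 0)
  -- (4) Cossart–Piltant: a regular member
  obtain ⟨r, hr⟩ := hCP p hp L O S hle f g x hreg hexc hdim (hO 0) halong hspan hrel hred hisol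
  -- (5) contradiction with the cleaned multiplicity at stage `r`
  haveI := hreg r
  haveI : CharP (S r) p := inferInstance
  obtain ⟨h, hh⟩ := hmult r
  exact RadicandChainTwo.not_isRegularLocalRing_of_sub_pow_mem_sq p
    (Ideal.pow_le_pow_right hp.two_le hh) hr

end NoEternalChainThree

end Summit.ResolutionOfSingularities.ResolutionOfSingularities.Theorems.SwitchingDichotomy

end
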